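import Mathlib.Combinatorics.Enumerative.Catalan.Basic
import Mathlib.Analysis.Calculus.SmoothSeries
import Mathlib.Analysis.Normed.Ring.InfiniteSum
import Mathlib.Analysis.SpecificLimits.Normed
import Mathlib.Analysis.Analytic.OfScalars
import Mathlib.Analysis.Calculus.FDeriv.Analytic
import Mathlib.Analysis.Calculus.ContDiff.Deriv
import Mathlib.Analysis.Calculus.Deriv.Pow
import Mathlib.Analysis.Calculus.Deriv.Mul
import HarnessLib

/-!
# Gavrilov's profile function `ψ` (the singular Cauchy problem of Lemma 1)

Topic `Literature/Analysis/FluidPDE`; support file for the discharge of the named fact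
`Literature.Analysis.FluidPDE.gavrilov_compact_steady_euler` (Gavrilov 2019, §1 Theorem).

Gavrilov (GAFA 29 (2019), §2.1, Lemma 1) needs the analytic solution `ψ` of the singular Cauchy
problem `3xψ'' + 6x(ψ')³ − 4ψ(ψ')² − 3ψ' = 0`, `ψ(0) = 1`, `ψ'(0) = −3/4` (his (1)), which he gets
from the Briot–Bouquet theory in Hille's book.  What the construction of §3 actually uses
(Lemma 2, identity (2a)) is the pair `(ψ, H)` with `H(α) = 6α(1/ψ' + 2ψ)` and
`H' = 24αψ' + 4ψ`; writing `Ψ = ∫₀ ψ` and `H = 24αψ − 20Ψ` (which has the printed derivative),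
the defining relation `H = 6α(1/ψ' + 2ψ)` becomes the polynomial identity
`(6αψ − 10Ψ) ψ' = 3α`, equivalent to Gavrilov's (1).

This file constructs `Ψ, ψ = Ψ', χ = ψ'` on the unit interval as explicit POWER SERIES and
proves that identity, sorry-free and without ODE theory:

* the Taylor coefficients `c₁ = 1, c₂ = −3/8, …` of `Ψ` satisfy the quadratic recursion
  `4k(k+1)c_{k+1} = Σ_{n=2}^{k} (k−n+2)(k−n+1)(6n−10) c_{k−n+2} c_n` (coefficient of `α^k` in
  the identity); in terms of `e_j = j(j−1)c_j` it is the Catalan-type recursion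
  `Gavrilov.profileAux` with weights `w_n = (6n−10)/(4n(n−1)) ∈ [0, 1/3]`, whence the majorant
  `|e_{m+2}| ≤ (3/4)(1/4)^m · catalan m ≤ 3/4` (`Gavrilov.abs_profileAux_le`): the series has
  radius of convergence `≥ 1` (Gavrilov only asserts analyticity near `0`; his printed Taylor
  coefficients `1, −3/4, 9/128, −21/1024` of `ψ` are `(j+1)c_{j+1}`, `Gavrilov.profile_taylor`);
* `Gavrilov.profilePrim = Ψ`, `Gavrilov.profile = ψ`, `Gavrilov.profileDeriv = χ` are the sums
  on `(−1, 1)`, with `Ψ' = ψ`, `ψ' = χ` (termwise differentiation), `Ψ` (hence `ψ`, `χ`) smooth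
  on `(−1, 1)`, `Ψ(0) = 0`, `ψ(0) = 1`, `χ(0) = −3/4`;
* `Gavrilov.profile_identity`: `(6αψ(α) − 10Ψ(α)) χ(α) = 3α` on `(−1, 1)` (Cauchy product);
* `Gavrilov.profileH = H = 24αψ − 20Ψ` with `H' = 4ψ + 24αχ` and `H χ = 6α + 12αψχ`
  (the two relations behind Gavrilov's (2a)), `H(0) = 0`, `H'(0) = 4`.

## References

* A. V. Gavrilov, *A steady Euler flow with compact support*, Geom. Funct. Anal. 29 (2019)
  190–197, §2.1 Lemma 1 (the function `ψ`, its Taylor series), Lemma 2 (`H`, `H' = 24αψ' + 4ψ`).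
  [`Gavrilov2019`]
* E. Hille, *Ordinary differential equations in the complex domain* (Dover 1997), the
  Briot–Bouquet theorem cited by Gavrilov as [H] (not needed here).
-/

noncomputable section

open Finset Filter Metric
open scoped Topology BigOperators

namespace Literature.Analysis.FluidPDE

namespace Gavrilov

/-! ### The Catalan-type coefficient recursion and its majorant -/

/-- The weights `w_n = (6n − 10) / (4n(n − 1))` of the coefficient recursion (meaningful for
`n ≥ 2`; junk value for `n = 0, 1`). [cite: Gavrilov2019, §2.1 Lemma 1] -/
def profileWeight (n : ℕ) : ℝ := (6 * n - 10) / (4 * n * (n - 1))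

/-- The weights are nonnegative for `n ≥ 2`. [folklore] -/
theorem profileWeight_nonneg {n : ℕ} (hn : 2 ≤ n) : 0 ≤ profileWeight n := by
  unfold profileWeight
  have h : (2 : ℝ) ≤ n := by exact_mod_cast hn
  apply div_nonneg <;> nlinarith

/-- The weights are at most `1/3` for `n ≥ 2` (`(2n − 5)(n − 3) ≥ 0` on the integers).
[folklore] -/
theorem profileWeight_le {n : ℕ} (hn : 2 ≤ n) : profileWeight n ≤ 1 / 3 := by
  unfold profileWeight
  have h : (2 : ℝ) ≤ n := by exact_mod_cast hn
  rw [div_le_div_iff₀ (by nlinarith) (by norm_num)]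
  rcases Nat.lt_or_ge n 3 with h3 | h3
  · have : n = 2 := by omega
    subst this
    norm_num
  · have h3' : (3 : ℝ) ≤ n := by exact_mod_cast h3
    nlinarith

/-- The Catalan-type sequence `e_{m+2} = (m+2)(m+1) c_{m+2}` of Gavrilov's profile:
`e₂ = −3/4`, `e_{m+3} = Σ_{i+j=m} e_{i+2} w_{i+2} e_{j+2}`. [cite: Gavrilov2019, §2.1 Lemma 1] -/
def profileAux : ℕ → ℝ
  | 0 => -3 / 4
  | m + 1 => ∑ i : Fin m.succ, profileAux i * profileWeight (i + 2) * profileAux (m - i)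

/-- `e₂ = −3/4`. [folklore] -/
@[simp] theorem profileAux_zero : profileAux 0 = -3 / 4 := by
  rw [profileAux]

/-- The recursion, `Fin`-indexed form. [folklore] -/
theorem profileAux_succ (m : ℕ) : profileAux (m + 1) =
    ∑ i : Fin m.succ, profileAux i * profileWeight (i + 2) * profileAux (m - i) := by
  rw [profileAux]

/-- The recursion, antidiagonal form. [folklore] -/
theorem profileAux_succ' (m : ℕ) : profileAux (m + 1) =
    ∑ ij ∈ antidiagonal m, profileAux ij.1 * profileWeight (ij.1 + 2) * profileAux ij.2 := by
  rw [profileAux_succ, Nat.sum_antidiagonal_eq_sum_range_succ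
    (fun x y => profileAux x * profileWeight (x + 2) * profileAux y) m, sum_range]

/-- **Catalan majorant**: `|e_{m+2}| ≤ (3/4)(1/4)^m · catalan m`. [folklore] -/
theorem abs_profileAux_le (m : ℕ) :
    |profileAux m| ≤ 3 / 4 * (1 / 4) ^ m * (catalan m : ℝ) := by
  induction m using Nat.strong_induction_on with
  | _ m ih =>
    cases m with
    | zero =>
      rw [profileAux_zero, abs_div, abs_neg, abs_of_pos (by norm_num : (0 : ℝ) < 3),
        abs_of_pos (by norm_num : (0 : ℝ) < 4)]
      simp
    | succ m =>
      rw [profileAux_succ', catalan_succ', Nat.cast_sum]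
      calc |∑ ij ∈ antidiagonal m, profileAux ij.1 * profileWeight (ij.1 + 2) * profileAux ij.2|
          ≤ ∑ ij ∈ antidiagonal m,
              |profileAux ij.1 * profileWeight (ij.1 + 2) * profileAux ij.2| :=
            abs_sum_le_sum_abs _ _
        _ ≤ ∑ ij ∈ antidiagonal m, (3 / 4 * (1 / 4) ^ ij.1 * (catalan ij.1 : ℝ)) * (1 / 3) *
              (3 / 4 * (1 / 4) ^ ij.2 * (catalan ij.2 : ℝ)) := by
            apply sum_le_sum
            intro ij hij
            have hm : ij.1 + ij.2 = m := mem_antidiagonal.1 hij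
            rw [abs_mul, abs_mul]
            have h1 := ih ij.1 (by omega)
            have h2 := ih ij.2 (by omega)
            have hw : |profileWeight (ij.1 + 2)| ≤ 1 / 3 := by
              rw [abs_of_nonneg (profileWeight_nonneg (by omega))]
              exact profileWeight_le (by omega)
            gcongr
        _ = 3 / 4 * (1 / 4) ^ (m + 1) *
              ∑ ij ∈ antidiagonal m, ((catalan ij.1 : ℝ) * (catalan ij.2 : ℝ)) := by
            rw [mul_sum]
            apply sum_congr rfl
            intro ij hij
            have hm : ij.1 + ij.2 = m := mem_antidiagonal.1 hij
            rw [← hm, pow_succ, pow_add]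
            ring
        _ = _ := by push_cast; ring

/-- The majorant summed up: `|e_j| ≤ 3/4` for all `j` (since `catalan m ≤ 4^m`). [folklore] -/
theorem abs_profileAux_le' (m : ℕ) : |profileAux m| ≤ 3 / 4 := by
  refine (abs_profileAux_le m).trans ?_
  have hc : (catalan m : ℝ) ≤ 4 ^ m := by
    have h1 : catalan m ≤ m.centralBinom := by
      rw [catalan_eq_centralBinom_div]
      exact Nat.div_le_self _ _
    exact_mod_cast h1.trans (Nat.centralBinom_le_four_pow m)
  calc 3 / 4 * (1 / 4) ^ m * (catalan m : ℝ) ≤ 3 / 4 * (1 / 4) ^ m * 4 ^ m := by gcongr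
    _ = 3 / 4 := by rw [mul_assoc, ← mul_pow]; norm_num

/-! ### The Taylor coefficients and the coefficient identity -/

/-- The Taylor coefficients `c_j` of `Ψ = ∫₀ ψ`: `c₀ = 0`, `c₁ = 1`,
`c_{m+2} = e_{m+2} / ((m+2)(m+1))`. [cite: Gavrilov2019, §2.1 Lemma 1] -/
def profileCoeff : ℕ → ℝ
  | 0 => 0
  | 1 => 1
  | m + 2 => profileAux m / ((m + 2) * (m + 1))

/-- `c₀ = 0`. [folklore] -/
@[simp] theorem profileCoeff_zero : profileCoeff 0 = 0 := rfl

/-- `c₁ = 1`. [folklore] -/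
@[simp] theorem profileCoeff_one : profileCoeff 1 = 1 := rfl

/-- `c_{m+2} = e_{m+2} / ((m+2)(m+1))`. [folklore] -/
theorem profileCoeff_add_two (m : ℕ) :
    profileCoeff (m + 2) = profileAux m / ((m + 2) * (m + 1)) := rfl

/-- `(m+2)(m+1) c_{m+2} = e_{m+2}`. [folklore] -/
theorem mul_profileCoeff_add_two (m : ℕ) :
    ((m : ℝ) + 2) * ((m : ℝ) + 1) * profileCoeff (m + 2) = profileAux m := by
  rw [profileCoeff_add_two]
  field_simp

/-- The Taylor coefficients are bounded by `1`. [folklore] -/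
theorem abs_profileCoeff_le (n : ℕ) : |profileCoeff n| ≤ 1 := by
  rcases n with _ | _ | m
  · simp
  · simp
  · rw [profileCoeff_add_two, abs_div]
    have hden : (0 : ℝ) < (m + 2) * (m + 1) := by positivity
    rw [abs_of_pos hden, div_le_one hden]
    have := abs_profileAux_le' m
    nlinarith

/-- Gavrilov's printed Taylor coefficients of `ψ = Ψ'`:
`ψ(x) = 1 − (3/4)x + (9/128)x² − (21/1024)x³ + …`, i.e. `2c₂ = −3/4`, `3c₃ = 9/128`,
`4c₄ = −21/1024`. [cite: Gavrilov2019, §2.1 (Taylor series of `ψ`)] -/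
theorem profile_taylor :
    2 * profileCoeff 2 = -3 / 4 ∧ 3 * profileCoeff 3 = 9 / 128 ∧
      4 * profileCoeff 4 = -21 / 1024 := by
  have h0 : profileAux 0 = -3 / 4 := profileAux_zero
  have h1 : profileAux 1 = 9 / 64 := by
    rw [profileAux_succ]
    simp [profileWeight]
    norm_num
  have h2 : profileAux 2 = -63 / 1024 := by
    rw [profileAux_succ]
    simp [Fin.sum_univ_succ, profileWeight, h1]
    norm_num
  refine ⟨?_, ?_, ?_⟩
  · rw [profileCoeff_add_two, h0]; norm_num
  · rw [show (3 : ℕ) = 1 + 2 from rfl, profileCoeff_add_two, h1]; norm_num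
  · rw [show (4 : ℕ) = 2 + 2 from rfl, profileCoeff_add_two, h2]; norm_num

/-- The coefficients `a_n = (6n − 10) c_n` of `6αψ − 10Ψ`. [folklore] -/
def seqA (n : ℕ) : ℝ := (6 * n - 10) * profileCoeff n

/-- The coefficients `b_n = (n+2)(n+1) c_{n+2}` of `χ = ψ'`. [folklore] -/
def seqB (n : ℕ) : ℝ := ((n : ℝ) + 2) * ((n : ℝ) + 1) * profileCoeff (n + 2)

/-- `b_n = e_{n+2}`. [folklore] -/
theorem seqB_eq (n : ℕ) : seqB n = profileAux n := mul_profileCoeff_add_two n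

/-- **The coefficient identity**: the Cauchy-product coefficient `Σ_{i+j=k} a_i b_j` of
`(6αψ − 10Ψ)·χ` is `3` for `k = 1` and `0` otherwise — this is exactly the recursion defining
`profileAux`. [cite: Gavrilov2019, §2.1 Lemma 1] -/
theorem sum_antidiagonal_seqA_mul_seqB (k : ℕ) :
    ∑ ij ∈ antidiagonal k, seqA ij.1 * seqB ij.2 = if k = 1 then 3 else 0 := by
  have hA0 : seqA 0 = 0 := by simp [seqA]
  have hA1 : seqA 1 = -4 := by simp [seqA]; norm_num
  have hA2 : ∀ i : ℕ, seqA (i + 2) = 4 * (profileAux i * profileWeight (i + 2)) := by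
    intro i
    rw [seqA, profileCoeff_add_two, profileWeight]
    push_cast
    have h3 : (i : ℝ) + 1 ≠ 0 := by positivity
    have h4 : (i : ℝ) + 2 ≠ 0 := by positivity
    rw [show (i : ℝ) + 2 - 1 = (i : ℝ) + 1 by ring]
    field_simp
  rcases k with _ | _ | m
  · simp [hA0]
  · rw [Nat.sum_antidiagonal_succ]
    simp [hA0, hA1, seqB_eq]
    norm_num
  · rw [Nat.sum_antidiagonal_succ, Nat.sum_antidiagonal_succ]
    simp only [hA0, zero_mul, zero_add, hA1, hA2, seqB_eq]
    rw [if_neg (by omega), profileAux_succ' m, mul_sum, ← sum_add_distrib]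
    exact sum_eq_zero fun ij _ => by ring

/-! ### Power series with polynomially bounded coefficients on `(−1, 1)` -/

/-- `Σ (n+1)^d ρ^n < ∞` for `0 ≤ ρ < 1`. [folklore] -/
theorem summable_succ_pow_mul_geometric (d : ℕ) {ρ : ℝ} (h0 : 0 ≤ ρ) (h1 : ρ < 1) :
    Summable fun n : ℕ => ((n : ℝ) + 1) ^ d * ρ ^ n := by
  have h : Summable fun n : ℕ => (n : ℝ) ^ d * ρ ^ n :=
    summable_pow_mul_geometric_of_norm_lt_one d (by rwa [Real.norm_eq_abs, abs_of_nonneg h0])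
  have h' : Summable fun n : ℕ => ((n + 1 : ℕ) : ℝ) ^ d * ρ ^ (n + 1) :=
    (summable_nat_add_iff 1).2 h
  rcases h0.eq_or_lt with h00 | hpos
  · subst h00
    apply summable_of_ne_finset_zero (s := {0})
    intro n hn
    have hn' : n ≠ 0 := by simpa using hn
    simp [zero_pow hn']
  · have heq : (fun n : ℕ => ((n : ℝ) + 1) ^ d * ρ ^ n) =
        fun n => ρ⁻¹ * (((n + 1 : ℕ) : ℝ) ^ d * ρ ^ (n + 1)) := by
      funext n
      rw [pow_succ]
      push_cast
      field_simp
    rw [heq]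
    exact h'.mul_left _

/-- Absolute convergence of `Σ aₙ αⁿ` on `(−1, 1)` for polynomially bounded coefficients.
[folklore] -/
theorem summable_norm_mul_pow {a : ℕ → ℝ} {M : ℝ} {d : ℕ}
    (ha : ∀ n, |a n| ≤ M * ((n : ℝ) + 1) ^ d) {α : ℝ} (hα : |α| < 1) :
    Summable fun n => ‖a n * α ^ n‖ := by
  have hM : 0 ≤ M := by simpa using (abs_nonneg _).trans (ha 0)
  refine Summable.of_nonneg_of_le (fun n => norm_nonneg _) (fun n => ?_)
    ((summable_succ_pow_mul_geometric d (abs_nonneg α) hα).mul_left M)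
  rw [Real.norm_eq_abs, abs_mul, abs_pow]
  calc |a n| * |α| ^ n ≤ M * ((n : ℝ) + 1) ^ d * |α| ^ n := by gcongr; exact ha n
    _ = M * (((n : ℝ) + 1) ^ d * |α| ^ n) := by ring

/-- Convergence of `Σ aₙ αⁿ` on `(−1, 1)` for polynomially bounded coefficients. [folklore] -/
theorem summable_mul_pow {a : ℕ → ℝ} {M : ℝ} {d : ℕ}
    (ha : ∀ n, |a n| ≤ M * ((n : ℝ) + 1) ^ d) {α : ℝ} (hα : |α| < 1) :
    Summable fun n => a n * α ^ n :=
  (summable_norm_mul_pow ha hα).of_norm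

/-- **Termwise differentiation** of `Σ aₙ xⁿ` on `(−1, 1)` for polynomially bounded
coefficients: the derivative at `α` is `Σ (n+1) a_{n+1} αⁿ`. [folklore] -/
theorem hasDerivAt_tsum_mul_pow {a : ℕ → ℝ} {M : ℝ} {d : ℕ}
    (ha : ∀ n, |a n| ≤ M * ((n : ℝ) + 1) ^ d) {α : ℝ} (hα : |α| < 1) :
    HasDerivAt (fun x => ∑' n, a n * x ^ n) (∑' n : ℕ, ((n : ℝ) + 1) * a (n + 1) * α ^ n) α := by
  have hM : 0 ≤ M := by simpa using (abs_nonneg _).trans (ha 0)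
  set ρ := (|α| + 1) / 2 with hρ
  have hρ0 : 0 < ρ := by rw [hρ]; positivity
  have hρ1 : ρ < 1 := by rw [hρ]; linarith
  have hαρ : |α| < ρ := by rw [hρ]; linarith
  set u : ℕ → ℝ := fun n => M / ρ * (((n : ℝ) + 1) ^ (d + 1) * ρ ^ n) with hu
  have hus : Summable u := (summable_succ_pow_mul_geometric (d + 1) hρ0.le hρ1).mul_left _
  have hg : ∀ (n : ℕ) (y : ℝ), y ∈ ball (0 : ℝ) ρ →
      HasDerivAt (fun x => a n * x ^ n) (a n * ((n : ℝ) * y ^ (n - 1))) y :=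
    fun n y _ => (hasDerivAt_pow n y).const_mul (a n)
  have hg' : ∀ (n : ℕ) (y : ℝ), y ∈ ball (0 : ℝ) ρ →
      ‖a n * ((n : ℝ) * y ^ (n - 1))‖ ≤ u n := by
    intro n y hy
    have hyρ : |y| ≤ ρ := by
      rw [mem_ball_zero_iff, Real.norm_eq_abs] at hy
      exact hy.le
    rcases n with _ | k
    · simp only [CharP.cast_eq_zero, zero_mul, mul_zero, norm_zero, hu]
      positivity
    · rw [hu, Real.norm_eq_abs, abs_mul, abs_mul, abs_pow, Nat.add_sub_cancel,
        Nat.abs_cast]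
      have h1 : |a (k + 1)| ≤ M * ((k : ℝ) + 2) ^ d := by
        have := ha (k + 1)
        push_cast at this
        convert this using 2
        ring
      have h2 : ((k + 1 : ℕ) : ℝ) ≤ (k : ℝ) + 2 := by push_cast; linarith
      have h3 : |y| ^ k ≤ ρ ^ k := pow_le_pow_left₀ (abs_nonneg y) hyρ k
      calc |a (k + 1)| * (((k + 1 : ℕ) : ℝ) * |y| ^ k)
          ≤ M * ((k : ℝ) + 2) ^ d * (((k : ℝ) + 2) * ρ ^ k) := by gcongr
        _ = M / ρ * ((((k + 1 : ℕ) : ℝ) + 1) ^ (d + 1) * ρ ^ (k + 1)) := by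
            push_cast
            rw [pow_succ, pow_succ]
            field_simp
            ring
  have hg0 : Summable fun n => a n * (0 : ℝ) ^ n := summable_mul_pow ha (by simp)
  have hαmem : α ∈ ball (0 : ℝ) ρ := by rwa [mem_ball_zero_iff, Real.norm_eq_abs]
  have key := hasDerivAt_tsum_of_isPreconnected hus isOpen_ball (convex_ball (0 : ℝ) ρ).isPreconnected
    hg hg' (mem_ball_self hρ0) hg0 hαmem
  -- reindex the derivative series: the `n = 0` term vanishes
  have hsd : Summable fun n => a n * ((n : ℝ) * α ^ (n - 1)) :=
    .of_norm_bounded hus fun n => hg' n α hαmem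
  refine key.congr_deriv ?_
  rw [hsd.tsum_eq_zero_add]
  simp only [CharP.cast_eq_zero, zero_mul, mul_zero, zero_add, Nat.add_sub_cancel]
  refine tsum_congr fun n => ?_
  push_cast
  ring

/-- A power series with bounded coefficients is smooth on `(−1, 1)` (it is analytic there).
[folklore] -/
theorem contDiffOn_tsum_mul_pow {a : ℕ → ℝ} {M : ℝ} (ha : ∀ n, |a n| ≤ M) {n : WithTop ℕ∞} :
    ContDiffOn ℝ n (fun x => ∑' k, a k * x ^ k) (ball (0 : ℝ) 1) := by
  let p : FormalMultilinearSeries ℝ ℝ ℝ := FormalMultilinearSeries.ofScalars ℝ a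
  have hrad : ((1 : NNReal) : ENNReal) ≤ p.radius := by
    refine p.le_radius_of_bound M fun k => ?_
    rw [NNReal.coe_one, one_pow, mul_one, FormalMultilinearSeries.ofScalars_norm,
      Real.norm_eq_abs]
    exact ha k
  have hpos : 0 < p.radius := lt_of_lt_of_le (by simp) hrad
  have hps : HasFPowerSeriesOnBall p.sum p 0 p.radius := p.hasFPowerSeriesOnBall hpos
  have han : AnalyticOnNhd ℝ p.sum (Metric.eball (0 : ℝ) p.radius) := hps.analyticOnNhd
  have hsub : ball (0 : ℝ) 1 ⊆ Metric.eball (0 : ℝ) p.radius := by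
    have hb : ball (0 : ℝ) 1 = Metric.eball (0 : ℝ) ((1 : NNReal) : ENNReal) := by
      rw [Metric.eball_coe, NNReal.coe_one]
    rw [hb]
    exact Metric.eball_subset_eball hrad
  have h1 : ContDiffOn ℝ n p.sum (ball (0 : ℝ) 1) :=
    (han.contDiffOn_of_completeSpace).mono hsub
  refine h1.congr fun x _ => ?_
  have := congrFun (FormalMultilinearSeries.ofScalarsSum_eq_tsum (E := ℝ) a) x
  simpa [FormalMultilinearSeries.ofScalarsSum, smul_eq_mul] using this.symm

/-! ### The profile functions `Ψ`, `ψ = Ψ'`, `χ = ψ'` -/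

/-- `Ψ(α) = Σ_j c_j α^j`, the primitive `∫₀^α ψ` of Gavrilov's profile (as a power series,
radius `≥ 1`). [cite: Gavrilov2019, §2.1 Lemma 1] -/
def profilePrim (α : ℝ) : ℝ := ∑' n, profileCoeff n * α ^ n

/-- Gavrilov's profile `ψ(α) = Σ_j (j+1) c_{j+1} α^j`, the analytic solution of his singular Cauchy
problem (1) (`ψ(0) = 1`, `ψ'(0) = −3/4`). [cite: Gavrilov2019, §2.1 Lemma 1] -/
def profile (α : ℝ) : ℝ := ∑' n : ℕ, ((n : ℝ) + 1) * profileCoeff (n + 1) * α ^ n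

/-- `χ = ψ'`, `χ(α) = Σ_j (j+2)(j+1) c_{j+2} α^j = Σ_j e_{j+2} α^j`. [cite: Gavrilov2019, §2.1 Lemma 1] -/
def profileDeriv (α : ℝ) : ℝ := ∑' n, seqB n * α ^ n

/-- Coefficient bound for `Ψ`. [folklore] -/
theorem abs_profileCoeff_le' (n : ℕ) : |profileCoeff n| ≤ 1 * ((n : ℝ) + 1) ^ 0 := by
  simpa using abs_profileCoeff_le n

/-- Coefficient bound for `ψ`. [folklore] -/
theorem abs_coeff_profile_le (n : ℕ) :
    |((n : ℝ) + 1) * profileCoeff (n + 1)| ≤ 1 * ((n : ℝ) + 1) ^ 1 := by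
  rw [abs_mul, pow_one, one_mul, abs_of_nonneg (by positivity : (0 : ℝ) ≤ (n : ℝ) + 1)]
  exact mul_le_of_le_one_right (by positivity) (abs_profileCoeff_le _)

/-- Coefficient bound for `χ`. [folklore] -/
theorem abs_seqB_le (n : ℕ) : |seqB n| ≤ 3 / 4 * ((n : ℝ) + 1) ^ 0 := by
  simpa [seqB_eq] using abs_profileAux_le' n

/-- Coefficient bound for `6αψ − 10Ψ`. [folklore] -/
theorem abs_seqA_le (n : ℕ) : |seqA n| ≤ 16 * ((n : ℝ) + 1) ^ 1 := by
  rw [seqA, abs_mul, pow_one]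
  have h1 : |(6 : ℝ) * n - 10| ≤ 16 * ((n : ℝ) + 1) := by
    rw [abs_le]
    constructor <;> nlinarith [n.cast_nonneg (α := ℝ)]
  calc |(6 : ℝ) * n - 10| * |profileCoeff n| ≤ 16 * ((n : ℝ) + 1) * 1 := by
        gcongr
        exact abs_profileCoeff_le n
    _ = 16 * ((n : ℝ) + 1) := mul_one _

/-- `Ψ' = ψ` on `(−1, 1)`. [cite: Gavrilov2019, §2.1 Lemma 1] -/
theorem hasDerivAt_profilePrim {α : ℝ} (hα : |α| < 1) :
    HasDerivAt profilePrim (profile α) α :=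
  hasDerivAt_tsum_mul_pow abs_profileCoeff_le' hα

/-- `ψ' = χ` on `(−1, 1)`. [cite: Gavrilov2019, §2.1 Lemma 1] -/
theorem hasDerivAt_profile {α : ℝ} (hα : |α| < 1) :
    HasDerivAt profile (profileDeriv α) α := by
  have h : HasDerivAt profile
      (∑' n : ℕ, ((n : ℝ) + 1) * (((((n + 1 : ℕ)) : ℝ) + 1) * profileCoeff (n + 1 + 1)) * α ^ n)
      α :=
    hasDerivAt_tsum_mul_pow abs_coeff_profile_le hα
  refine h.congr_deriv (tsum_congr fun n => ?_)
  rw [seqB, show n + 1 + 1 = n + 2 from rfl]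
  push_cast
  ring

/-- `Ψ` is smooth on `(−1, 1)`. [folklore] -/
theorem contDiffOn_profilePrim {n : WithTop ℕ∞} : ContDiffOn ℝ n profilePrim (ball (0 : ℝ) 1) :=
  contDiffOn_tsum_mul_pow abs_profileCoeff_le

/-- `ψ` is smooth on `(−1, 1)`. [folklore] -/
theorem contDiffOn_profile {n : WithTop ℕ∞} : ContDiffOn ℝ n profile (ball (0 : ℝ) 1) := by
  have h1 : ContDiffOn ℝ (n + 1) profilePrim (ball (0 : ℝ) 1) := contDiffOn_profilePrim
  have h2 := ((contDiffOn_succ_iff_deriv_of_isOpen isOpen_ball).1 h1).2.2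
  refine h2.congr fun x hx => ?_
  rw [mem_ball_zero_iff, Real.norm_eq_abs] at hx
  exact ((hasDerivAt_profilePrim hx).deriv).symm

/-- `χ` is smooth on `(−1, 1)`. [folklore] -/
theorem contDiffOn_profileDeriv {n : WithTop ℕ∞} :
    ContDiffOn ℝ n profileDeriv (ball (0 : ℝ) 1) := by
  have h1 : ContDiffOn ℝ (n + 1) profile (ball (0 : ℝ) 1) := contDiffOn_profile
  have h2 := ((contDiffOn_succ_iff_deriv_of_isOpen isOpen_ball).1 h1).2.2
  refine h2.congr fun x hx => ?_
  rw [mem_ball_zero_iff, Real.norm_eq_abs] at hx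
  exact ((hasDerivAt_profile hx).deriv).symm

/-- `Ψ(0) = 0`. [folklore] -/
@[simp] theorem profilePrim_zero : profilePrim 0 = 0 := by
  rw [profilePrim, tsum_eq_single 0]
  · simp
  · intro n hn
    simp [zero_pow hn]

/-- `ψ(0) = 1` (Gavrilov's initial condition). [cite: Gavrilov2019, §2.1 (1)] -/
@[simp] theorem profile_zero : profile 0 = 1 := by
  rw [profile, tsum_eq_single 0]
  · simp
  · intro n hn
    simp [zero_pow hn]

/-- `ψ'(0) = χ(0) = −3/4` (Gavrilov's initial condition). [cite: Gavrilov2019, §2.1 (1)] -/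
@[simp] theorem profileDeriv_zero : profileDeriv 0 = -3 / 4 := by
  rw [profileDeriv, tsum_eq_single 0]
  · simp [seqB_eq]
  · intro n hn
    simp [zero_pow hn]

/-- `6αψ(α) − 10Ψ(α) = Σ a_n α^n` on `(−1, 1)`. [folklore] -/
theorem six_mul_profile_sub {α : ℝ} (hα : |α| < 1) :
    6 * α * profile α - 10 * profilePrim α = ∑' n, seqA n * α ^ n := by
  have hb6 : ∀ n : ℕ, |6 * (n : ℝ) * profileCoeff n| ≤ 6 * ((n : ℝ) + 1) ^ 1 := by
    intro n
    rw [abs_mul, abs_mul, pow_one, Nat.abs_cast, abs_of_pos (by norm_num : (0 : ℝ) < 6)]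
    calc 6 * (n : ℝ) * |profileCoeff n| ≤ 6 * (n : ℝ) * 1 := by
          gcongr
          exact abs_profileCoeff_le n
      _ ≤ 6 * ((n : ℝ) + 1) := by linarith
  have hs6 : Summable fun n : ℕ => 6 * (n : ℝ) * profileCoeff n * α ^ n := summable_mul_pow hb6 hα
  have hs0 : Summable fun n => profileCoeff n * α ^ n := summable_mul_pow abs_profileCoeff_le' hα
  have h6 : 6 * α * profile α = ∑' n : ℕ, 6 * (n : ℝ) * profileCoeff n * α ^ n := by
    rw [hs6.tsum_eq_zero_add, profile, ← tsum_mul_left]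
    simp only [CharP.cast_eq_zero, mul_zero, zero_mul, zero_add]
    refine tsum_congr fun n => ?_
    push_cast
    ring
  have h10 : 10 * profilePrim α = ∑' n : ℕ, 10 * (profileCoeff n * α ^ n) := by
    rw [profilePrim, tsum_mul_left]
  rw [h6, h10, ← hs6.tsum_sub (hs0.mul_left 10)]
  refine tsum_congr fun n => ?_
  rw [seqA]
  ring

/-- **Gavrilov's singular ODE (1), integrated form**: `(6αψ(α) − 10Ψ(α)) ψ'(α) = 3α` on
`(−1, 1)`; equivalently `H = 6α(1/ψ' + 2ψ)` for `H = 24αψ − 20Ψ`, i.e. Lemma 2's `H`, and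
differentiating once more gives the printed second-order equation
`3xψ'' + 6x(ψ')³ − 4ψ(ψ')² − 3ψ' = 0`. [cite: Gavrilov2019, §2.1 Lemma 1 and Lemma 2] -/
theorem profile_identity {α : ℝ} (hα : |α| < 1) :
    (6 * α * profile α - 10 * profilePrim α) * profileDeriv α = 3 * α := by
  rw [six_mul_profile_sub hα, profileDeriv,
    tsum_mul_tsum_eq_tsum_sum_antidiagonal_of_summable_norm (summable_norm_mul_pow abs_seqA_le hα)
      (summable_norm_mul_pow abs_seqB_le hα)]
  have hterm : ∀ n, ∑ kl ∈ antidiagonal n, seqA kl.1 * α ^ kl.1 * (seqB kl.2 * α ^ kl.2) =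
      (if n = 1 then 3 else 0) * α ^ n := by
    intro n
    rw [← sum_antidiagonal_seqA_mul_seqB n, sum_mul]
    refine sum_congr rfl fun kl hkl => ?_
    rw [← mem_antidiagonal.1 hkl, pow_add]
    ring
  rw [tsum_congr hterm, tsum_eq_single 1]
  · simp
  · intro n hn
    simp [hn]

/-! ### The function `H` of Lemma 2 -/

/-- Gavrilov's `H(α) = 6α(1/ψ'(α) + 2ψ(α))`, rendered division-free as `H = 24αψ − 20Ψ`
(the two agree by `profile_identity`). [cite: Gavrilov2019, §2.1 (definition of `H`)] -/
def profileH (α : ℝ) : ℝ := 24 * α * profile α - 20 * profilePrim α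

/-- `H(0) = 0`. [folklore] -/
@[simp] theorem profileH_zero : profileH 0 = 0 := by
  simp [profileH]

/-- **Lemma 2's derivative formula** `H'(α) = 24αψ'(α) + 4ψ(α)` on `(−1, 1)`.
[cite: Gavrilov2019, §2.1 Lemma 2 (proof)] -/
theorem hasDerivAt_profileH {α : ℝ} (hα : |α| < 1) :
    HasDerivAt profileH (4 * profile α + 24 * α * profileDeriv α) α := by
  have h24 : HasDerivAt (fun x : ℝ => 24 * x) 24 α := by
    simpa using (hasDerivAt_id α).const_mul 24
  have h : HasDerivAt (fun x => 24 * x * profile x - 20 * profilePrim x)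
      (24 * profile α + 24 * α * profileDeriv α - 20 * profile α) α :=
    (h24.fun_mul (hasDerivAt_profile hα)).fun_sub ((hasDerivAt_profilePrim hα).const_mul 20)
  refine (h.congr_deriv ?_).congr_of_eventuallyEq (Eventually.of_forall fun x => rfl)
  ring

/-- **The defining relation of `H`**, division-free: `H ψ' = 6α + 12αψψ'` on `(−1, 1)`
(i.e. `H = 6α(1/ψ' + 2ψ)` wherever `ψ' ≠ 0`). [cite: Gavrilov2019, §2.1 (definition of `H`)] -/
theorem profileH_mul_profileDeriv {α : ℝ} (hα : |α| < 1) :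
    profileH α * profileDeriv α = 6 * α + 12 * α * profile α * profileDeriv α := by
  have h := profile_identity hα
  unfold profileH
  linear_combination 2 * h

/-- `H'(0) = 4`. [folklore] -/
theorem hasDerivAt_profileH_zero : HasDerivAt profileH 4 0 := by
  simpa using hasDerivAt_profileH (α := 0) (by simp)

end Gavrilov

end Literature.Analysis.FluidPDE
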